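import Literature.MathematicalPhysics.QuantumFieldTheory.Balaban1983to89.B12Semisimple414

/-!
# Bałaban CMP 109 (1987) §4 pp. 283–284: (4.7) + «The group G is semisimple» ⇒ (4.11) AT `B = 0` (print's
`k₂ = 1/12`) and the SECOND Ward–Takahashi identity (4.15)₂ «⟨(δ³/δB³)𝐄(1), B₁, B₂, ∂λ⟩ − ⟨(δ²/δB²)𝐄(1), B₁,
i[λ₋, B₂] − ½i[B₂, ∂λ]⟩ − (B₁↔B₂) = 0» AT `B = 0` IN THE CHART `V = exp iB` OF `𝔤`-VALUED GAUGE FIELDS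

CITATION HEADER (lean-in-tree rule 2026-08-18).
* Source: T. Bałaban, "Renormalization group approach to lattice gauge field theories. I. Generation of effective
  actions in a small field approximation and a coupling constant renormalization in four dimensions", Commun. Math.
  Phys. **109** (1987) 249–301, doi:10.1007/bf01215223 [Balaban1987RG1] (cell paper B12; held:
  `paper:balaban1987-cmp109-rg-i-small-field`; PDF page = journal page − 248), §4 pp. 282–284 and p. 289, displays
  (4.7)–(4.11), (4.13)–(4.15), (4.32)–(4.33).  The sentences and displays of pp. 283, 284 and 289 quoted below were
  READ AS IMAGES by the author of this file on the 300-dpi renders of the audit cell (`HOME/b2b-balaban-ref1/pages/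
  1987-cmp109-rg-I-small-field/…-p035-x2.png` = p. 283, `…-p036-x2.png` = p. 284, `…-p041-x2.png` = p. 289; HOME = the
  cell folder `run/shared/lean/pub/pub-balaban/`), (4.7) of p. 282 is quoted as in the grandparent's header
  (`…B12GaugeInv47`, whose author read `…-p034-x2.png`), and all agree with the lineage transcript
  `HOME/b2b-balaban-b03/B12s-transcript.md`; inside quotation marks nothing is altered.  Audit cell `pub-balaban`,
  unit `b2b-balaban-b03-g22` (PAPER SUB-CELL B03 → B12 §§2–5 lineage, gen 22), node B12-WARD-SECOND-415.  Imports only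
  the lineage's own accepted module `…B12Semisimple414` (gen 21: the chart calculus to second order
  `fderiv_chart_zero_apply`, `fderiv_fderiv_chart_zero_apply`, `fderiv_comp_chart_zero_apply`,
  `fderiv_fderiv_comp_chart_zero_apply`, (4.7) ⇒ (4.13) `hessian_one_apply_grad_eq`, (4.14) in the chart
  `fderiv_one_apply_rho_eq_zero`, closure / perfectness from semisimplicity `exists_rho_eq_commutator`,
  `span_commutatorSet_eq_top_of_isSemisimple`; through it `…B12GaugeInv47` (gen 20: (4.7) ⇒ (4.9)
  `fderiv_apply_gaugeGenerator_eq_zero`, the generator `exists_generatorCLM`) and `…B12Ward414` (gen 5: the abstract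
  second-order Ward identity `ward_second_order`, the calculus helpers `fderiv_eval_along`, `fderiv_eval_const`) and
  Mathlib's `NormedSpace.exp`, `expSeries`, `Equiv.Perm.decomposeFin`); modifies nothing.
* Statements reproduced (verbatim).  p. 282 [PDF 34] (4.7): *"𝐄(V^v) = 𝐄(V), V^v(b) = v(b₋)V(b)v⁻¹(b₊)."*  p. 283
  [PDF 35]: *"For a small gauge field V = exp iB, and a small gauge transformation v = exp iλ, B and λ small, we
  have"* (4.8) *"V^v(b) = exp iλ(b₋) exp iB(b) exp(−iλ(b₊)) = exp i(exp iad_{λ(b₋)}B(b)) exp i(λ(b₋) − λ(b₊) −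
  ½i[λ(b₋), λ(b₊)] + …), (1/i) log V^v(b) = exp iad_{λ(b₋)}B(b) + g⁻¹(iad_{exp iad_{λ(b₋)}B(b)})(λ(b₋) − λ(b₊) − …)
  + … = B(b) + i[λ(b₋), B(b)] − g⁻¹(iad_{B(b)})(δλ)(b) + … [sic: (δλ)(b) = (∂λ)(b) of (4.9)], where the dots denote
  terms of higher order in λ, and g⁻¹(z) = (−z)/(e^{−z} − 1) = 1 + ½z + k₂z² + …."*  *"Now differentiate the
  equality (4.7) with respect to λ, at λ = 0. This gives the identity"* (4.9) *"⟨(δ/δB)𝐄(exp iB), i[λ(b₋), B(b)] −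
  g⁻¹(iad_{B(b)})(∂λ)(b)⟩ = 0 holding for all 𝔤^c-valued functions λ, and small, 𝔤^c-valued configurations B. It
  is the fundamental identity expressing the gauge invariance of the function 𝐄."*  *"From this we derive a whole
  sequence of identities by differentiations with respect to B. For our purpose it is enough to consider expressions
  with four derivatives at most. Let us write the corresponding sequence of identities"* (4.10) *"⟨(δ²/δB²)𝐄(exp
  iB), iad_{λ₋}B − g⁻¹(iad_B)∂λ, B₁⟩ + ⟨(δ/δB)𝐄(exp iB), iad_{λ₋}B₁ − ½iad_{B₁}∂λ − k₂{iad_{B₁}, iad_B}∂λ − …⟩ = 0,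
  where {A, B} = AB + BA;"* (4.11)
  *"⟨(δ³/δB³)𝐄(exp iB), iad_{λ₋}B − g⁻¹(iad_B)∂λ, B₁, B₂⟩ + ⟨(δ²/δB²)𝐄(exp iB), iad_{λ₋}B₂ − ½iad_{B₂}∂λ −
  k₂{iad_{B₂}, iad_B}∂λ − …, B₁⟩ + (B₁↔B₂) + ⟨(δ/δB)𝐄(exp iB), −k₂{iad_{B₁}, iad_{B₂}}∂λ − …⟩ = 0,"*; p. 284
  [PDF 36]: *"where the symbol (B₁↔B₂) denotes an expression obtained from the preceding one by the exchange of B₁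
  with B₂;"*.  p. 284: *"We are interested in the above identities at B = 0, because such expressions only appear in
  the sum (4.6). This simplifies them in an essential way."* […] (4.14) *"(δ/δB)𝐄(1) = 0.  This equality simplifies
  the identities, and also the sum (4.6), we can drop the term with n = 1. We obtain the following set of
  Ward-Takahashi identities"* (4.15) *"⟨(δ²/δB²)𝐄(1), B₁, ∂λ⟩ = 0, ⟨(δ³/δB³)𝐄(1), B₁, B₂, ∂λ⟩ − ⟨(δ²/δB²)𝐄(1), B₁,
  i[λ₋, B₂] − ½i[B₂, ∂λ]⟩ − (B₁↔B₂) = 0,"* […] *"for an arbitrary gauge function λ, and arbitrary gauge fields B₁, B₂,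
  B₃."*  p. 289 [PDF 41]: *"The basic identity (4.9) holds for all gauge transformations, hence for constant
  transformations it is 𝐄(exp iR(v)B) = 𝐄(exp iB), and it implies"* (4.32) *"⟨𝐄^{(2)}, R(v)B, R(v)B⟩ = ⟨𝐄^{(2)}, B,
  B⟩, v ∈ G."* *"The corresponding function 𝐄^{(2)}_{μ,ν}(x,y) has values in the tensor product 𝔤⊗𝔤, and the above
  identity implies"* (4.33) *"R(v)⊗R(v)𝐄^{(2)}_{μ,ν}(x,y) = 𝐄^{(2)}_{μ,ν}(x,y), v ∈ G."* *"The infinitesimal form of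
  this identity is a consequence of (4.11), or the second identity in (4.15)."*  And the bond convention, p. 284:
  *"The field B_μ(x) = B(x, x + e_μ) = […]"*.  (Inside quotation marks `[…]` marks an omission by the author of this
  file; print's own dots `…` are print's.)
* Dictionary print → Lean (the only modelling choices; all bookkeeping, no analysis) — EXACTLY the parent's
  (`…B12Semisimple414`): bonds `b = (x, x + e_ν)` of a finite torus `T` (shifts `e : Λ → T`), the AMBIENT gauge field
  `W : Λ → T → 𝔄` with values in a complete normed real algebra `𝔄` (print: `M_N(ℂ) ⊃ G^c`), the functional
  `ℰ : (Λ → T → 𝔄) → F` (print's 𝐄), «analytic» weakened to `C³` at `W = 1`, the gauge action (4.7)/(4.8)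
  `W ↦ (exp(tΛ(x)) W_ν(x) exp(−tΛ(x + e_ν)))_{ν,x}` (Mathlib's `NormedSpace.exp`), `(∂λ)_ν(y) = λ(y + e_ν) − λ(y)`; the
  Lie algebra a real normed space `V` represented in `𝔄` by `ρ : V →L[ℝ] 𝔄` (print: `𝔤^c ⊂ M_N(ℂ)`; EVERY factor `i`
  of print — `exp iB`, `exp iλ`, `iad`, `i[·, ·]` — is absorbed into `ρ`: print's `iQ` is our `ρq`, so print's
  `i[λ, B]` is the `𝔤`-element represented by the commutator `[ρλ, ρB]` and print's `½i[B₂, ∂λ]` the one represented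
  by `½[ρB₂, ρ∂λ]`); the chart `B ↦ (exp ρ(B_ν(x)))_{ν,x}` on `𝔤`-valued fields `B : Λ → T → V`, written out as a lambda
  in every statement; gauge functions `λ : T → V` acting through `Λ = ρ ∘ λ`; «The group G is semisimple» through
  CLOSURE `hcl : ∀ a b, ∃ c, ρc = ρa·ρb − ρb·ρa` and PERFECTNESS `hspan : span {c | ρc = [ρl, ρv]} = V`, both derived
  from Mathlib's `LieAlgebra.IsSemisimple ℝ 𝔤` in the parent (`…_of_isSemisimple` wrappers below).  The second
  variation `B₂ ↦ i[λ₋, B₂] − ½i[B₂, ∂λ]` of (4.15)₂ is a `𝔤`-valued field `c_v` prescribed through `ρ`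
  (`hcv : ρ(c_v)_ν(x) = [ρλ(x), ρv_ν(x)] − ½[ρv_ν(x), ρλ(x + e_ν) − ρλ(x)]`, i.e. `λ₋ = λ(x)`, `∂λ` on the bond), or
  built from any bracket function `br` with `ρ(br a b) = [ρa, ρb]` (`…_of_bracket`).  The module is DEFINITION-FREE.
  AMBIENT-TYPING CAVEAT (as in the parent): `ℰ` is asked to be `C³` at `1` and gauge invariant near `1` as a function
  of the AMBIENT `𝔄`-valued field; every conclusion concerns only the chart functional `B ↦ ℰ(exp ρB)` of `𝔤`-valued
  fields, so this strengthens the HYPOTHESIS only; the extension is NOT constructed here.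
* The mathematics (print's «differentiations with respect to B» done at `B = 0` through the chart; the one place
  where print is silent — how (4.11) at `B = 0` sees the coefficients `½` and `k₂` of `g⁻¹` — made explicit).  For
  `f(B) = ℰ(exp ρB)`, `U = ρu`, `V = ρv`, `P = ρ∂λ`, `M = ρλ₋`, `N = ρλ₊` on a bond: (i) the chart calculus to THIRD
  order, `d³exp(0)(a, b, c) = ⅙ Σ_{σ∈S₃} a_σ b_σ c_σ` (Mathlib's exponential SERIES, `expSeries`, and the symmetrised
  Taylor formula `HasFPowerSeriesOnBall.iteratedFDeriv_eq_sum_of_completeSpace`, the six permutations enumerated by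
  `Equiv.Perm.decomposeFin`) and the third-order chain rule `D³f(0)(u, v, w) = D³ℰ(1)(U, V, W) + D²ℰ(1)(J(u,v), W) +
  D²ℰ(1)(U, J(v,w)) + D²ℰ(1)(V, J(u,w)) + Dℰ(1)[S₃(u,v,w)]`, `J = ½{U, V}` (print's `{A, B} = AB + BA`); (ii) (4.7) ⇒
  (4.9) `Dℰ(W)[Λ₋W − WΛ₊] = 0` NEAR `W = 1` (grandparent) ⇒ its SECOND `W`-derivative at `1`
  (`…B12Ward414.ward_second_order` for the affine generator `U ↦ L_Λ(1 + U)`): `D³ℰ(1)(U₁, U₂, ∂Λ) = D²ℰ(1)(U₁, Λ₋U₂ −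
  U₂Λ₊) + D²ℰ(1)(U₂, Λ₋U₁ − U₁Λ₊)` — (4.11) at `B = 0` in the ambient coordinates; (iii) two POINTWISE identities in
  the free algebra: the `D²ℰ(1)(U, ·)`-slot `(MV − VN) + ½{V, P} = [M, V] − ½[V, P]` (print's «iad_{λ₋}B₂ −
  ½iad_{B₂}∂λ») and the `Dℰ(1)`-slot `(MJ − JN) + S₃(U, V, P) − J(U, c_v) − J(V, c_u) = (1/12)([U, [P, V]] + [V, [P,
  U]])` — print's «−k₂{iad_{B₁}, iad_{B₂}}∂λ» with `k₂ = 1/12`, the `z²`-coefficient of `g⁻¹(z) = −z/(e^{−z} − 1)`, here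
  PRODUCED by the kernel from `½ = 1/2!` and `⅙ = 1/3!` of the exponential series rather than read off print; (iv) the
  residual is `Dℰ(1)` of a `𝔤`-VALUED field (closure, twice), which (4.14)-in-the-chart (parent) kills: (4.15)₂.

WHAT IS PROVED (kernel-checked, no `sorry`, standard axioms, NO definitions; bookkeeping theorems, every analytic
input a NAMED HYPOTHESIS):
* §1 [folklore] `sum_perm_fin_three` (enumeration of `S₃`); `expSeries_apply_three`, `iteratedFDeriv_exp_zero_three`
  (`d³exp(0)(a,b,c) = ⅙ Σ_{S₃} abc`), `iteratedFDeriv_three_apply`, `fderiv_fderiv_fderiv_chart_zero_apply` (the third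
  derivative of the chart at `0`, sitewise `⅙ Σ_{S₃}`).
* §2 [folklore] the second- and third-order chain rules at a point for `C²`/`C³` maps between normed spaces,
  `fderiv_fderiv_comp_apply'`, `fderiv_fderiv_fderiv_comp_apply`, and in the chart at `B = 0`,
  `fderiv_fderiv_fderiv_comp_chart_zero_apply`.
* §3 [folklore] the two pointwise identities `gen_add_jordan_eq_commutator_sub`,
  `residual_eq_twelfth_double_commutators`.
* §4 `third_one_apply_grad_eq` — **(4.7) ⇒ (4.11) at `B = 0` in the ambient `V`-coordinates**:
  `D³ℰ(1)(U₁, U₂, ∂Λ) = D²ℰ(1)(U₁, Λ₋U₂ − U₂Λ₊) + D²ℰ(1)(U₂, Λ₋U₁ − U₁Λ₊)`.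
* §5 `third_chart_apply_grad_eq` — **(4.11) AT `B = 0` IN THE CHART, for ONE `𝔤`-valued `λ`, WITHOUT (4.14)**:
  `D³f(0)(u, v, ∂λ) − D²f(0)(u, c_v) − D²f(0)(v, c_u) = Dℰ(1)[(1/12)([U,[P,V]] + [V,[P,U]])]` — print's (4.11) at
  `B = 0` with its last term `⟨(δ/δB)𝐄(1), −k₂{iad_{B₁}, iad_{B₂}}∂λ⟩`, `k₂ = 1/12`, moved to the right.
* §6 `third_chart_apply_grad_eq_zero` — **(4.7) + closure + perfectness ⇒ (4.15)₂ at `B = 0` in the chart**: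
  `D³f(0)(B₁, B₂, ∂λ) − D²f(0)(B₁, c_{B₂}) − D²f(0)(B₂, c_{B₁}) = 0` for all `𝔤`-valued `B₁`, `B₂`, `λ` and any
  representatives `c_{B₂}`, `c_{B₁}` of `i[λ₋, B₂] − ½i[B₂, ∂λ]`, `i[λ₋, B₁] − ½i[B₁, ∂λ]`;
  `third_chart_apply_grad_eq_zero_of_bracket` (the same with `c` built from a bracket function `br`) and
  `third_chart_apply_grad_eq_zero_of_isSemisimple` (closure and perfectness from `LieAlgebra.IsSemisimple ℝ 𝔤`);
  `hessian_chart_ad_invariant` (+ `_of_isSemisimple`) — p. 289, after (4.32)–(4.33): «The infinitesimal form of this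
  identity is a consequence of (4.11), or the second identity in (4.15).»: (4.15)₂ for CONSTANT `λ = l` gives
  `D²f(0)(B₁, [l, B₂]) + D²f(0)(B₂, [l, B₁]) = 0` (infinitesimal `Ad`-invariance of the quadratic form `D²f(0)` on
  `𝔤`-valued fields; print's `𝐄^{(2)}`, `R(v)` are not modelled).

WHAT IS NOT PROVED HERE (and not claimed): (4.10)–(4.12) AWAY from `B = 0` and the third identity (4.15)₃ / (4.12) at
`B = 0` (they need one more order of everything: `d⁴exp(0)`, the fourth-order chain rule, `…B12Ward414.ward_third_order`
and the `k₂`-terms of the `D²`-slot); the `B`-dependent generator `i[λ₋, B] − g⁻¹(iad_B)∂λ` itself (`d log` away from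
`0`) — the identities here are obtained WITHOUT it, from the ambient flow, and print's coefficients `½`, `k₂ = 1/12`
appear as OUTPUT; the existence, analyticity and invariance of print's effective actions `𝐄^{(j)}` (B12 §§2–3), the
consequences (4.16) ff. drawn from (4.15)₂ on pp. 284–291 ((4.29)–(4.31), the Schur-lemma step after (4.33)); the
ambient extension of the caveat above; nothing about B13 or the continuum limit.  The abstract second-order identity
`…B12Ward414.ward_second_order_of_fderiv_eq_zero` (gen 5, hypotheses: a `C²` generator FIELD `X` on the chart with
`Df(B)[X(B)] = 0` near `0`, and (4.14)) is NOT used: its hypothesis `X` is exactly the `d log`-generator not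
constructed in the lineage; the present file replaces it by the ambient flow of (4.7).

HONEST FRAMING: value = print's second Ward–Takahashi identity (4.15)₂ — the one that drives pp. 288–291 ((4.29)–(4.33),
the reduction of the marginal sum (4.20) to `𝐄^{(2)}`) — is now a kernel-checked consequence, at `B = 0` in print's
own setting of `𝔤`-valued `B`, `λ`, of exactly the inputs print names ((4.7) and «The group G is semisimple»), with
print's implicit bookkeeping (third-order chart calculus, the coefficients `½`, `k₂` of (4.8)) done over Mathlib's
exponential series and CONFIRMING `k₂ = 1/12`; plus the p. 289 remark on infinitesimal `Ad`-invariance.  NOT summit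
progress: bookkeeping of printed displays; every analytic statement remains a hypothesis.
-/

namespace Literature.MathematicalPhysics.QuantumFieldTheory.Balaban1983to89.B12WardSecond415

open Literature.MathematicalPhysics.QuantumFieldTheory.Balaban1983to89.B12Ward414 (ward_second_order
  fderiv_eval_along fderiv_eval_const)
open Literature.MathematicalPhysics.QuantumFieldTheory.Balaban1983to89.B12GaugeInv47 (exists_generatorCLM
  fderiv_apply_gaugeGenerator_eq_zero)
open Literature.MathematicalPhysics.QuantumFieldTheory.Balaban1983to89.B12Semisimple414 (contDiff_exp chart_zero
  contDiff_chart fderiv_chart_zero_apply fderiv_fderiv_chart_zero_apply fderiv_comp_chart_zero_apply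
  fderiv_fderiv_comp_chart_zero_apply hessian_one_apply_grad_eq fderiv_one_apply_rho_eq_zero exists_rho_eq_commutator
  span_commutatorSet_eq_top_of_isSemisimple)
open NormedSpace (exp exp_zero expSeries exp_hasFPowerSeriesOnBall)
open Filter
open _root_.Topology

/-! ## §1. [folklore] `S₃`, the cubic term of the exponential series, the third derivative of the chart at `0` -/

section SymmetricGroupThree

open Equiv

/-- Row expansion of a sum over the permutations of `Fin (n+1)` (`Finset.univ_perm_fin_succ`). [folklore] -/
private theorem sum_perm_fin_succ_eq_sum_decomposeFin {α : Type*} [AddCommMonoid α] {n : ℕ}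
    (f : Perm (Fin (n + 1)) → α) :
    ∑ σ, f σ = ∑ p : Fin (n + 1), ∑ e : Perm (Fin n), f (Perm.decomposeFin.symm (p, e)) := by
  rw [Finset.univ_perm_fin_succ, Finset.sum_map, ← Finset.univ_product_univ, Finset.sum_product]
  rfl

/-- Row-expansion bookkeeping in `S₃`: `decomposeFin⁻¹(p,e)(1) = (0 p)(e(0)+1)`. [folklore] -/
private theorem dfs3_one (e : Perm (Fin 2)) (p : Fin 3) :
    Perm.decomposeFin.symm (p, e) 1 = swap 0 p (e 0).succ :=
  Perm.decomposeFin_symm_apply_succ e p 0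

/-- Row-expansion bookkeeping in `S₃`: `decomposeFin⁻¹(p,e)(2) = (0 p)(e(1)+1)`. [folklore] -/
private theorem dfs3_two (e : Perm (Fin 2)) (p : Fin 3) :
    Perm.decomposeFin.symm (p, e) 2 = swap 0 p (e 1).succ :=
  Perm.decomposeFin_symm_apply_succ e p 1

/-- Row-expansion bookkeeping in `S₂`: `decomposeFin⁻¹(p,e)(1) = (0 p)(e(0)+1)`. [folklore] -/
private theorem dfs2_one (e : Perm (Fin 1)) (p : Fin 2) :
    Perm.decomposeFin.symm (p, e) 1 = swap 0 p (e 0).succ :=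
  Perm.decomposeFin_symm_apply_succ e p 0

/-- **Enumeration of `S₃`**: `Σ_{σ ∈ S₃} g(σ0, σ1, σ2)` written out as its six terms. [folklore] -/
theorem sum_perm_fin_three {α : Type*} [AddCommMonoid α] (g : Fin 3 → Fin 3 → Fin 3 → α) :
    ∑ σ : Perm (Fin 3), g (σ 0) (σ 1) (σ 2) = g 0 1 2 + g 0 2 1 + g 1 0 2 + g 1 2 0 + g 2 0 1 + g 2 1 0 := by
  simp only [sum_perm_fin_succ_eq_sum_decomposeFin, Fin.sum_univ_succ, Finset.univ_unique, Finset.sum_singleton,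
    Perm.decomposeFin_symm_apply_zero, dfs3_one, dfs3_two, dfs2_one]
  simp [Equiv.swap_apply_def]
  abel

end SymmetricGroupThree

section ExpThird

variable {𝔄 : Type*} [NormedRing 𝔄] [NormedAlgebra ℝ 𝔄] [CompleteSpace 𝔄]

omit [CompleteSpace 𝔄] in
/-- The cubic term of Mathlib's exponential series: `(expSeries ℝ 𝔄 3)(a, b, c) = ⅙·abc`. [folklore] -/
theorem expSeries_apply_three (m : Fin 3 → 𝔄) : expSeries ℝ 𝔄 3 m = (6 : ℝ)⁻¹ • (m 0 * m 1 * m 2) := by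
  have h3 : Nat.factorial 3 = 6 := rfl
  simp [expSeries, h3, List.ofFn_succ, mul_assoc]

/-- **`d³exp(0)(a, b, c) = ⅙(abc + acb + bac + bca + cab + cba)`** in a complete normed real algebra: the third
derivative at `0` of an analytic function is the symmetrisation of the cubic term of its power series
(`HasFPowerSeriesOnBall.iteratedFDeriv_eq_sum_of_completeSpace` for `NormedSpace.exp_hasFPowerSeriesOnBall`).
[folklore] -/
theorem iteratedFDeriv_exp_zero_three (m : Fin 3 → 𝔄) :
    iteratedFDeriv ℝ 3 (exp : 𝔄 → 𝔄) 0 m = (6 : ℝ)⁻¹ • (m 0 * m 1 * m 2 + m 0 * m 2 * m 1 + m 1 * m 0 * m 2 +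
      m 1 * m 2 * m 0 + m 2 * m 0 * m 1 + m 2 * m 1 * m 0) := by
  rw [(exp_hasFPowerSeriesOnBall (𝕂 := ℝ) (𝔸 := 𝔄)).iteratedFDeriv_eq_sum_of_completeSpace]
  simp only [expSeries_apply_three]
  rw [← Finset.smul_sum, sum_perm_fin_three (fun i j k => m i * m j * m k)]

/-- `D³f(z)(m₀, m₁, m₂) = fderiv (fderiv (fderiv f)) z m₀ m₁ m₂` (Mathlib's curried iterated derivative, three
times). [folklore] -/
theorem iteratedFDeriv_three_apply {E F : Type*} [NormedAddCommGroup E] [NormedSpace ℝ E] [NormedAddCommGroup F]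
    [NormedSpace ℝ F] (f : E → F) (z : E) (m : Fin 3 → E) :
    iteratedFDeriv ℝ 3 f z m = fderiv ℝ (fderiv ℝ (fderiv ℝ f)) z (m 0) (m 1) (m 2) := by
  rw [iteratedFDeriv_succ_apply_right, iteratedFDeriv_two_apply]
  rfl

variable {Λ T : Type*} [Fintype Λ] [Fintype T] {V : Type*} [NormedAddCommGroup V] [NormedSpace ℝ V]
  {F : Type*} [NormedAddCommGroup F] [NormedSpace ℝ F]

/-- **`d³(exp iρB)|_{B=0}(u, v, w) = (⅙ Σ_{S₃} ρu_ν(x)·ρv_ν(x)·ρw_ν(x))_{ν,x}`** — the third derivative of the chart is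
SITEWISE the symmetrised triple product (`iteratedFDeriv_exp_zero_three` at every bond, through the evaluation
maps; the pattern of the parent's `fderiv_fderiv_chart_zero_apply`). [folklore] -/
theorem fderiv_fderiv_fderiv_chart_zero_apply (ρ : V →L[ℝ] 𝔄) (u v w : Λ → T → V) :
    fderiv ℝ (fderiv ℝ (fderiv ℝ (fun B : Λ → T → V => fun ν x => exp (ρ (B ν x))))) 0 u v w =
      fun ν x => (6 : ℝ)⁻¹ • (ρ (u ν x) * ρ (v ν x) * ρ (w ν x) + ρ (u ν x) * ρ (w ν x) * ρ (v ν x) +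
        ρ (v ν x) * ρ (u ν x) * ρ (w ν x) + ρ (v ν x) * ρ (w ν x) * ρ (u ν x) +
        ρ (w ν x) * ρ (u ν x) * ρ (v ν x) + ρ (w ν x) * ρ (v ν x) * ρ (u ν x)) := by
  funext ν x
  set Φ : (Λ → T → V) → Λ → T → 𝔄 := fun B ν x => exp (ρ (B ν x)) with hΦ
  have hC : ContDiff ℝ 3 Φ := contDiff_chart ρ
  -- the evaluation at the bond `(ν, x)` and the linear map `B ↦ ρ(B_ν(x))`
  set ev : (Λ → T → 𝔄) →L[ℝ] 𝔄 := (ContinuousLinearMap.proj (R := ℝ) (φ := fun _ : T => 𝔄) x).comp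
    (ContinuousLinearMap.proj (R := ℝ) (φ := fun _ : Λ => T → 𝔄) ν) with hev
  set L : (Λ → T → V) →L[ℝ] 𝔄 := ρ.comp ((ContinuousLinearMap.proj (R := ℝ) (φ := fun _ : T => V) x).comp
    (ContinuousLinearMap.proj (R := ℝ) (φ := fun _ : Λ => T → V) ν)) with hL
  have h1 : (ev : (Λ → T → 𝔄) → 𝔄) ∘ Φ = (exp : 𝔄 → 𝔄) ∘ (L : (Λ → T → V) → 𝔄) := by
    funext B
    simp [hΦ, hev, hL]
  calc fderiv ℝ (fderiv ℝ (fderiv ℝ Φ)) 0 u v w ν x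
      = ev (iteratedFDeriv ℝ 3 Φ 0 ![u, v, w]) := by
          rw [iteratedFDeriv_three_apply]
          simp [hev]
    _ = iteratedFDeriv ℝ 3 ((ev : (Λ → T → 𝔄) → 𝔄) ∘ Φ) 0 ![u, v, w] := by
          rw [ev.iteratedFDeriv_comp_left hC.contDiffAt (i := 3) le_rfl]
          rfl
    _ = iteratedFDeriv ℝ 3 ((exp : 𝔄 → 𝔄) ∘ (L : (Λ → T → V) → 𝔄)) 0 ![u, v, w] := by rw [h1]
    _ = iteratedFDeriv ℝ 3 (exp : 𝔄 → 𝔄) (L 0) (fun i => L (![u, v, w] i)) := by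
          rw [L.iteratedFDeriv_comp_right (contDiff_exp (n := 3)) 0 (i := 3) le_rfl]
          rfl
    _ = iteratedFDeriv ℝ 3 (exp : 𝔄 → 𝔄) 0 ![ρ (u ν x), ρ (v ν x), ρ (w ν x)] := by
          rw [map_zero]
          congr 1
          funext i
          fin_cases i <;> simp [hL]
    _ = _ := by
          rw [iteratedFDeriv_exp_zero_three]
          simp

end ExpThird

/-! ## §2. [folklore] The second- and third-order chain rules at a point, and in the chart at `B = 0` -/

section ChainRule

variable {𝕜 : Type*} [NontriviallyNormedField 𝕜] {E G H : Type*} [NormedAddCommGroup E] [NormedSpace 𝕜 E]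
  [NormedAddCommGroup G] [NormedSpace 𝕜 G] [NormedAddCommGroup H] [NormedSpace 𝕜 H]

/-- **Second-order chain rule at a point**: for `Φ` `C²` at `x` and `ℰ` `C²` at `Φ x`,
`D²(ℰ∘Φ)(x)(u, v) = D²ℰ(Φx)(DΦ(x)u, DΦ(x)v) + Dℰ(Φx)[D²Φ(x)(u, v)]` (the chain rule near `x`, then the product rule
`…B12Ward414.fderiv_eval_along` at `x`). [folklore] -/
theorem fderiv_fderiv_comp_apply' {Φ : E → G} {ℰ : G → H} {x : E} (hΦ : ContDiffAt 𝕜 2 Φ x)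
    (hℰ : ContDiffAt 𝕜 2 ℰ (Φ x)) (u v : E) :
    fderiv 𝕜 (fderiv 𝕜 (fun B => ℰ (Φ B))) x u v =
      fderiv 𝕜 (fderiv 𝕜 ℰ) (Φ x) (fderiv 𝕜 Φ x u) (fderiv 𝕜 Φ x v) +
        fderiv 𝕜 ℰ (Φ x) (fderiv 𝕜 (fderiv 𝕜 Φ) x u v) := by
  have hΦnear : ∀ᶠ B in 𝓝 x, ContDiffAt 𝕜 2 Φ B := hΦ.eventually (by simp)
  have hℰnear : ∀ᶠ B in 𝓝 x, ContDiffAt 𝕜 2 ℰ (Φ B) :=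
    hΦ.continuousAt.tendsto.eventually (hℰ.eventually (by simp))
  -- (chain rule near `x`) `D(ℰ∘Φ)(B) v = Dℰ(Φ B)[DΦ(B) v]`
  have hv : (fun B => fderiv 𝕜 (fun B => ℰ (Φ B)) B v) =ᶠ[𝓝 x]
      fun B => fderiv 𝕜 ℰ (Φ B) (fderiv 𝕜 Φ B v) := by
    filter_upwards [hΦnear, hℰnear] with B hB hB'
    rw [fderiv_fun_comp (x := B) (hB'.differentiableAt (by simp)) (hB.differentiableAt (by simp))]
    rfl
  have hf : ContDiffAt 𝕜 2 (fun B => ℰ (Φ B)) x := hℰ.comp x hΦ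
  have hd1 : DifferentiableAt 𝕜 (fderiv 𝕜 (fun B => ℰ (Φ B))) x :=
    (hf.fderiv_right (m := 1) (by norm_num)).differentiableAt (by simp)
  have hℰ'd : DifferentiableAt 𝕜 (fderiv 𝕜 ℰ) (Φ x) :=
    (hℰ.fderiv_right (m := 1) (by norm_num)).differentiableAt (by simp)
  have hΦd : DifferentiableAt 𝕜 Φ x := hΦ.differentiableAt (by simp)
  have hA : DifferentiableAt 𝕜 (fun B => fderiv 𝕜 ℰ (Φ B)) x := hℰ'd.comp x hΦd
  have hΦ'd : DifferentiableAt 𝕜 (fderiv 𝕜 Φ) x :=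
    (hΦ.fderiv_right (m := 1) (by norm_num)).differentiableAt (by simp)
  have hY : DifferentiableAt 𝕜 (fun B => fderiv 𝕜 Φ B v) x := hΦ'd.clm_apply (differentiableAt_const v)
  have hDA : fderiv 𝕜 (fun B => fderiv 𝕜 ℰ (Φ B)) x u = fderiv 𝕜 (fderiv 𝕜 ℰ) (Φ x) (fderiv 𝕜 Φ x u) := by
    rw [fderiv_fun_comp (x := x) hℰ'd hΦd]
    rfl
  rw [← fderiv_eval_const hd1 v u, hv.fderiv_eq, fderiv_eval_along hA hY u, fderiv_eval_const hΦ'd v u, hDA,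
    add_comm]

/-- **Third-order chain rule at a point**: for `Φ` `C³` at `x` and `ℰ` `C³` at `Φ x`,
`D³(ℰ∘Φ)(x)(u, v, w) = D³ℰ(DΦu, DΦv, DΦw) + D²ℰ(D²Φ(u,v), DΦw) + D²ℰ(DΦu, D²Φ(v,w)) + D²ℰ(DΦv, D²Φ(u,w)) +
Dℰ[D³Φ(u,v,w)]` (all at `x` / `Φ x`).  Proof: near `x`, `D(ℰ∘Φ)(B)w = A(B)·Y(B)` with `A = Dℰ∘Φ`, `Y = DΦ(·)w`;
differentiate twice with the product rule, using the chain rules of orders one and two for `A`. [folklore] -/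
theorem fderiv_fderiv_fderiv_comp_apply {Φ : E → G} {ℰ : G → H} {x : E} (hΦ : ContDiffAt 𝕜 3 Φ x)
    (hℰ : ContDiffAt 𝕜 3 ℰ (Φ x)) (u v w : E) :
    fderiv 𝕜 (fderiv 𝕜 (fderiv 𝕜 (fun B => ℰ (Φ B)))) x u v w =
      fderiv 𝕜 (fderiv 𝕜 (fderiv 𝕜 ℰ)) (Φ x) (fderiv 𝕜 Φ x u) (fderiv 𝕜 Φ x v) (fderiv 𝕜 Φ x w)
      + fderiv 𝕜 (fderiv 𝕜 ℰ) (Φ x) (fderiv 𝕜 (fderiv 𝕜 Φ) x u v) (fderiv 𝕜 Φ x w)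
      + fderiv 𝕜 (fderiv 𝕜 ℰ) (Φ x) (fderiv 𝕜 Φ x u) (fderiv 𝕜 (fderiv 𝕜 Φ) x v w)
      + fderiv 𝕜 (fderiv 𝕜 ℰ) (Φ x) (fderiv 𝕜 Φ x v) (fderiv 𝕜 (fderiv 𝕜 Φ) x u w)
      + fderiv 𝕜 ℰ (Φ x) (fderiv 𝕜 (fderiv 𝕜 (fderiv 𝕜 Φ)) x u v w) := by
  -- `C³` data near `x`
  have hΦnear : ∀ᶠ B in 𝓝 x, ContDiffAt 𝕜 3 Φ B := hΦ.eventually (by simp)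
  have hℰnear : ∀ᶠ B in 𝓝 x, ContDiffAt 𝕜 3 ℰ (Φ B) :=
    hΦ.continuousAt.tendsto.eventually (hℰ.eventually (by simp))
  have hΦ2 : ContDiffAt 𝕜 2 Φ x := hΦ.of_le (by norm_num)
  have hℰ' : ContDiffAt 𝕜 2 (fderiv 𝕜 ℰ) (Φ x) := hℰ.fderiv_right (m := 2) (by norm_num)
  have hf : ContDiffAt 𝕜 3 (fun B => ℰ (Φ B)) x := hℰ.comp x hΦ
  have hA : ContDiffAt 𝕜 2 (fun B => fderiv 𝕜 ℰ (Φ B)) x := hℰ'.comp x hΦ2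
  have hY : ContDiffAt 𝕜 2 (fun B => fderiv 𝕜 Φ B w) x :=
    (hΦ.fderiv_right (m := 2) (by norm_num)).clm_apply contDiffAt_const
  have hg : ContDiffAt 𝕜 2 (fun B => fderiv 𝕜 ℰ (Φ B) (fderiv 𝕜 Φ B w)) x := hA.clm_apply hY
  -- Step 1 (chain rule near `x`): `D(ℰ∘Φ)(B) w = Dℰ(Φ B)[DΦ(B) w] =: g(B)`
  have hgw : (fun B => fderiv 𝕜 (fun B => ℰ (Φ B)) B w) =ᶠ[𝓝 x]
      fun B => fderiv 𝕜 ℰ (Φ B) (fderiv 𝕜 Φ B w) := by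
    filter_upwards [hΦnear, hℰnear] with B hB hB'
    rw [fderiv_fun_comp (x := B) (hB'.differentiableAt (by simp)) (hB.differentiableAt (by simp))]
    rfl
  -- Step 2: near `x`, `D²(ℰ∘Φ)(B')(v, w) = Dg(B') v`
  have h2 : (fun B' => fderiv 𝕜 (fderiv 𝕜 (fun B => ℰ (Φ B))) B' v w) =ᶠ[𝓝 x]
      fun B' => fderiv 𝕜 (fun B => fderiv 𝕜 ℰ (Φ B) (fderiv 𝕜 Φ B w)) B' v := by
    have hfnear : ∀ᶠ B' in 𝓝 x, ContDiffAt 𝕜 3 (fun B => ℰ (Φ B)) B' := hf.eventually (by simp)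
    filter_upwards [hfnear, hgw.eventually_nhds] with B' hB' hgB'
    have hd : DifferentiableAt 𝕜 (fderiv 𝕜 (fun B => ℰ (Φ B))) B' :=
      (hB'.fderiv_right (m := 2) (by norm_num)).differentiableAt (by simp)
    have hgB'' : (fun B => fderiv 𝕜 (fun B => ℰ (Φ B)) B w) =ᶠ[𝓝 B']
        fun B => fderiv 𝕜 ℰ (Φ B) (fderiv 𝕜 Φ B w) := hgB'
    rw [← fderiv_eval_const hd w v, hgB''.fderiv_eq]
  -- Step 3: `D³(ℰ∘Φ)(x)(u, v, w) = D²g(x)(u, v)`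
  have hdg : DifferentiableAt 𝕜 (fderiv 𝕜 (fun B => fderiv 𝕜 ℰ (Φ B) (fderiv 𝕜 Φ B w))) x :=
    (hg.fderiv_right (m := 1) (by norm_num)).differentiableAt (by simp)
  have h3 : fderiv 𝕜 (fderiv 𝕜 (fderiv 𝕜 (fun B => ℰ (Φ B)))) x u v w =
      fderiv 𝕜 (fderiv 𝕜 (fun B => fderiv 𝕜 ℰ (Φ B) (fderiv 𝕜 Φ B w))) x u v := by
    have hd2 : DifferentiableAt 𝕜 (fderiv 𝕜 (fderiv 𝕜 (fun B => ℰ (Φ B)))) x :=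
      ((hf.fderiv_right (m := 2) (by norm_num)).fderiv_right (m := 1) (by norm_num)).differentiableAt (by simp)
    have hd2v : DifferentiableAt 𝕜 (fun B => fderiv 𝕜 (fderiv 𝕜 (fun B => ℰ (Φ B))) B v) x :=
      hd2.clm_apply (differentiableAt_const v)
    rw [← fderiv_eval_const hd2 v u, ← fderiv_eval_const hd2v w u, h2.fderiv_eq, fderiv_eval_const hdg v u]
  -- Step 4 (product rule near `x`): `Dg(B') v = A(B')[D²Φ(B')(v, w)] + (DA(B') v)[DΦ(B') w]`
  have hAd : ∀ᶠ B in 𝓝 x, DifferentiableAt 𝕜 (fun B => fderiv 𝕜 ℰ (Φ B)) B := by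
    filter_upwards [hΦnear, hℰnear] with B hB hB'
    exact ((hB'.fderiv_right (m := 2) (by norm_num)).differentiableAt (by simp)).comp B
      (hB.differentiableAt (by simp))
  have hΦ'd : ∀ᶠ B in 𝓝 x, DifferentiableAt 𝕜 (fderiv 𝕜 Φ) B := by
    filter_upwards [hΦnear] with B hB
    exact (hB.fderiv_right (m := 2) (by norm_num)).differentiableAt (by simp)
  have h4 : (fun B' => fderiv 𝕜 (fun B => fderiv 𝕜 ℰ (Φ B) (fderiv 𝕜 Φ B w)) B' v) =ᶠ[𝓝 x]
      fun B' => fderiv 𝕜 ℰ (Φ B') (fderiv 𝕜 (fderiv 𝕜 Φ) B' v w) +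
        fderiv 𝕜 (fun B => fderiv 𝕜 ℰ (Φ B)) B' v (fderiv 𝕜 Φ B' w) := by
    filter_upwards [hAd, hΦ'd] with B' hA' hΦ'
    rw [fderiv_eval_along hA' (hΦ'.clm_apply (differentiableAt_const w)) v, fderiv_eval_const hΦ' w v]
  -- Step 5: differentiate Step 4 at `x` in the direction `u`
  have hAx : DifferentiableAt 𝕜 (fun B => fderiv 𝕜 ℰ (Φ B)) x := hAd.self_of_nhds
  have hΦ'x : DifferentiableAt 𝕜 (fderiv 𝕜 Φ) x := hΦ'd.self_of_nhds
  have hΦ''x : DifferentiableAt 𝕜 (fderiv 𝕜 (fderiv 𝕜 Φ)) x :=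
    ((hΦ.fderiv_right (m := 2) (by norm_num)).fderiv_right (m := 1) (by norm_num)).differentiableAt (by simp)
  have hΦ''vx : DifferentiableAt 𝕜 (fun B => fderiv 𝕜 (fderiv 𝕜 Φ) B v) x :=
    hΦ''x.clm_apply (differentiableAt_const v)
  have hA'x : DifferentiableAt 𝕜 (fderiv 𝕜 (fun B => fderiv 𝕜 ℰ (Φ B))) x :=
    (hA.fderiv_right (m := 1) (by norm_num)).differentiableAt (by simp)
  have hA'vx : DifferentiableAt 𝕜 (fun B => fderiv 𝕜 (fun B => fderiv 𝕜 ℰ (Φ B)) B v) x :=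
    hA'x.clm_apply (differentiableAt_const v)
  -- the chain rules of orders one and two for `A = Dℰ ∘ Φ` at `x`
  have hDA : ∀ z, fderiv 𝕜 (fun B => fderiv 𝕜 ℰ (Φ B)) x z = fderiv 𝕜 (fderiv 𝕜 ℰ) (Φ x) (fderiv 𝕜 Φ x z) := by
    intro z
    rw [fderiv_fun_comp (x := x) (hℰ'.differentiableAt (by simp)) (hΦ.differentiableAt (by simp))]
    rfl
  have hDDA : fderiv 𝕜 (fderiv 𝕜 (fun B => fderiv 𝕜 ℰ (Φ B))) x u v =
      fderiv 𝕜 (fderiv 𝕜 (fderiv 𝕜 ℰ)) (Φ x) (fderiv 𝕜 Φ x u) (fderiv 𝕜 Φ x v) +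
        fderiv 𝕜 (fderiv 𝕜 ℰ) (Φ x) (fderiv 𝕜 (fderiv 𝕜 Φ) x u v) :=
    fderiv_fderiv_comp_apply' hΦ2 hℰ' u v
  rw [h3, ← fderiv_eval_const hdg v u, h4.fderiv_eq,
    fderiv_fun_add (hAx.clm_apply (hΦ''vx.clm_apply (differentiableAt_const w)))
      (hA'vx.clm_apply (hΦ'x.clm_apply (differentiableAt_const w))),
    _root_.add_apply, fderiv_eval_along hAx (hΦ''vx.clm_apply (differentiableAt_const w)) u,
    fderiv_eval_along hA'vx (hΦ'x.clm_apply (differentiableAt_const w)) u, fderiv_eval_const hΦ''vx w u,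
    fderiv_eval_const hΦ''x v u, fderiv_eval_const hΦ'x w u, fderiv_eval_const hA'x v u, hDA, hDA, hDDA,
    _root_.add_apply]
  abel

end ChainRule

section ChartThird

variable {𝔄 : Type*} [NormedRing 𝔄] [NormedAlgebra ℝ 𝔄] [CompleteSpace 𝔄] {Λ T : Type*} [Fintype Λ] [Fintype T]
  {V : Type*} [NormedAddCommGroup V] [NormedSpace ℝ V] {F : Type*} [NormedAddCommGroup F] [NormedSpace ℝ F]

/-- **Third-order chain rule at `B = 0` in the chart**: for `f(B) = 𝐄(exp iρB)` and `𝐄` `C³` at `1`,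
`D³f(0)(u, v, w) = D³𝐄(1)(ρu, ρv, ρw) + D²𝐄(1)(½{ρu, ρv}, ρw) + D²𝐄(1)(ρu, ½{ρv, ρw}) + D²𝐄(1)(ρv, ½{ρu, ρw}) +
D𝐄(1)[⅙ Σ_{S₃} ρu ρv ρw]` (sitewise products; `{A, B} = AB + BA` as in print's (4.10)). [folklore] -/
theorem fderiv_fderiv_fderiv_comp_chart_zero_apply {ℰ : (Λ → T → 𝔄) → F} (ρ : V →L[ℝ] 𝔄)
    (hℰ : ContDiffAt ℝ 3 ℰ 1) (u v w : Λ → T → V) :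
    fderiv ℝ (fderiv ℝ (fderiv ℝ (fun B : Λ → T → V => ℰ (fun ν x => exp (ρ (B ν x)))))) 0 u v w =
      fderiv ℝ (fderiv ℝ (fderiv ℝ ℰ)) 1 (fun ν x => ρ (u ν x)) (fun ν x => ρ (v ν x)) (fun ν x => ρ (w ν x))
      + fderiv ℝ (fderiv ℝ ℰ) 1 (fun ν x => (2 : ℝ)⁻¹ • (ρ (u ν x) * ρ (v ν x) + ρ (v ν x) * ρ (u ν x)))
          (fun ν x => ρ (w ν x))
      + fderiv ℝ (fderiv ℝ ℰ) 1 (fun ν x => ρ (u ν x))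
          (fun ν x => (2 : ℝ)⁻¹ • (ρ (v ν x) * ρ (w ν x) + ρ (w ν x) * ρ (v ν x)))
      + fderiv ℝ (fderiv ℝ ℰ) 1 (fun ν x => ρ (v ν x))
          (fun ν x => (2 : ℝ)⁻¹ • (ρ (u ν x) * ρ (w ν x) + ρ (w ν x) * ρ (u ν x)))
      + fderiv ℝ ℰ 1 (fun ν x => (6 : ℝ)⁻¹ • (ρ (u ν x) * ρ (v ν x) * ρ (w ν x) +
          ρ (u ν x) * ρ (w ν x) * ρ (v ν x) + ρ (v ν x) * ρ (u ν x) * ρ (w ν x) +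
          ρ (v ν x) * ρ (w ν x) * ρ (u ν x) + ρ (w ν x) * ρ (u ν x) * ρ (v ν x) +
          ρ (w ν x) * ρ (v ν x) * ρ (u ν x))) := by
  set Φ : (Λ → T → V) → Λ → T → 𝔄 := fun B ν x => exp (ρ (B ν x)) with hΦ
  show fderiv ℝ (fderiv ℝ (fderiv ℝ (fun B : Λ → T → V => ℰ (Φ B)))) 0 u v w = _
  have hC : ContDiff ℝ 3 Φ := contDiff_chart ρ
  have hΦ0 : Φ 0 = 1 := chart_zero ρ
  have hΦ1 : ∀ u : Λ → T → V, fderiv ℝ Φ 0 u = fun ν x => ρ (u ν x) := fderiv_chart_zero_apply ρ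
  have hΦ2 : ∀ u w : Λ → T → V, fderiv ℝ (fderiv ℝ Φ) 0 u w =
      fun ν x => (2 : ℝ)⁻¹ • (ρ (u ν x) * ρ (w ν x) + ρ (w ν x) * ρ (u ν x)) :=
    fderiv_fderiv_chart_zero_apply ρ
  have hΦ3 : ∀ u v w : Λ → T → V, fderiv ℝ (fderiv ℝ (fderiv ℝ Φ)) 0 u v w =
      fun ν x => (6 : ℝ)⁻¹ • (ρ (u ν x) * ρ (v ν x) * ρ (w ν x) + ρ (u ν x) * ρ (w ν x) * ρ (v ν x) +
        ρ (v ν x) * ρ (u ν x) * ρ (w ν x) + ρ (v ν x) * ρ (w ν x) * ρ (u ν x) +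
        ρ (w ν x) * ρ (u ν x) * ρ (v ν x) + ρ (w ν x) * ρ (v ν x) * ρ (u ν x)) :=
    fderiv_fderiv_fderiv_chart_zero_apply ρ
  have hℰ' : ContDiffAt ℝ 3 ℰ (Φ 0) := by
    rw [hΦ0]
    exact hℰ
  rw [fderiv_fderiv_fderiv_comp_apply hC.contDiffAt hℰ' u v w]
  simp only [hΦ0, hΦ1, hΦ2, hΦ3]

end ChartThird

/-! ## §3. [folklore] The two pointwise identities in the free algebra -/

section Algebra

variable {𝔄 : Type*} [Ring 𝔄] [Algebra ℝ 𝔄]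

/-- Cancelling a non-zero real scalar. [folklore] -/
private theorem eq_of_smul_eq {c : ℝ} (hc : c ≠ 0) {a b : 𝔄} (h : c • a = c • b) : a = b := by
  rw [← inv_smul_smul₀ hc a, ← inv_smul_smul₀ hc b, h]

/-- The `D²𝐄(1)(ρB₁, ·)`-slot of (4.11) at `B = 0`: `(MV − VN) + ½(VP + PV) = [M, V] − ½[V, P]`, `P = N − M`
(`M = ρλ₋`, `N = ρλ₊`): the generator term of (4.9) plus the Jordan term of the chart is print's second variation
«iad_{λ₋}B₂ − ½iad_{B₂}∂λ», a commutator expression. [folklore] -/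
theorem gen_add_jordan_eq_commutator_sub (M N V : 𝔄) :
    M * V - V * N + (2 : ℝ)⁻¹ • (V * (N - M) + (N - M) * V) =
      (M * V - V * M) - (2 : ℝ)⁻¹ • (V * (N - M) - (N - M) * V) := by
  apply eq_of_smul_eq (two_ne_zero (α := ℝ))
  simp only [smul_add, smul_sub, smul_inv_smul₀ (two_ne_zero (α := ℝ))]
  simp only [two_smul]
  noncomm_ring

/-- The `D𝐄(1)`-slot of (4.11) at `B = 0`: with `J = ½(UV + VU)`, `S₃ = ⅙ Σ_{S₃} UVP`, `c_V = [M, V] − ½[V, P]`,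
`c_U = [M, U] − ½[U, P]`, `P = N − M`:  `(MJ − JN) + S₃ − ½(Uc_V + c_VU) − ½(Vc_U + c_UV) = (1/12)((U[P,V] − [P,V]U)
+ (V[P,U] − [P,U]V))` — print's «−k₂{iad_{B₁}, iad_{B₂}}∂λ» moved to the right, WITH `k₂ = 1/12` (the
`z²`-coefficient of `g⁻¹(z) = −z/(e^{−z} − 1) = 1 + ½z + k₂z² + …` of (4.8)). [folklore] -/
theorem residual_eq_twelfth_double_commutators (M N U V : 𝔄) :
    M * ((2 : ℝ)⁻¹ • (U * V + V * U)) - ((2 : ℝ)⁻¹ • (U * V + V * U)) * N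
      + (6 : ℝ)⁻¹ • (U * V * (N - M) + U * (N - M) * V + V * U * (N - M) + V * (N - M) * U +
          (N - M) * U * V + (N - M) * V * U)
      - (2 : ℝ)⁻¹ • (U * ((M * V - V * M) - (2 : ℝ)⁻¹ • (V * (N - M) - (N - M) * V)) +
          ((M * V - V * M) - (2 : ℝ)⁻¹ • (V * (N - M) - (N - M) * V)) * U)
      - (2 : ℝ)⁻¹ • (V * ((M * U - U * M) - (2 : ℝ)⁻¹ • (U * (N - M) - (N - M) * U)) +
          ((M * U - U * M) - (2 : ℝ)⁻¹ • (U * (N - M) - (N - M) * U)) * V) =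
      (12 : ℝ)⁻¹ • ((U * ((N - M) * V - V * (N - M)) - ((N - M) * V - V * (N - M)) * U) +
        (V * ((N - M) * U - U * (N - M)) - ((N - M) * U - U * (N - M)) * V)) := by
  have h12 : (12 : ℝ) ≠ 0 := by norm_num
  apply eq_of_smul_eq h12
  simp only [smul_add, smul_sub, mul_add, add_mul, mul_sub, sub_mul, mul_smul_comm, smul_mul_assoc, smul_smul,
    smul_inv_smul₀ h12]
  norm_num
  simp only [ofNat_smul_eq_nsmul]
  noncomm_ring

end Algebra

/-! ## §4. (4.7) ⇒ (4.11) at `B = 0` in the ambient `V`-coordinates -/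

section WardSecondAmbient

variable {𝔄 : Type*} [NormedRing 𝔄] [NormedAlgebra ℝ 𝔄] [CompleteSpace 𝔄] {Λ T : Type*} [Fintype Λ] [Fintype T]
  [AddCommGroup T] {F : Type*} [NormedAddCommGroup F] [NormedSpace ℝ F]

-- The doubly nested operator space `(Λ → T → 𝔄) →L[ℝ] (Λ → T → 𝔄) →L[ℝ] F` over the iterated `Pi` type needs more
-- levels of pending instance synthesis than Lean's default (as in Mathlib's `OperatorNorm` files).
set_option maxSynthPendingDepth 3 in
/-- **(4.11) at `B = 0` in `V`-coordinates, WITHOUT (4.14)** (p. 283 «From this we derive a whole sequence of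
identities by differentiations with respect to B.» (4.11)): if `𝐄` is `C³` at `V = 1` and invariant under the gauge
flow of `Λ` ((4.7)) near `V = 1` for small `t`, then for all directions `U₁`, `U₂`
`D³𝐄(1)(U₁, U₂, ∂Λ) = D²𝐄(1)(U₁, Λ(b₋)U₂(b) − U₂(b)Λ(b₊)) + D²𝐄(1)(U₂, Λ(b₋)U₁(b) − U₁(b)Λ(b₊))` — the SECOND
`W`-derivative at `1` of the identically vanishing (4.9) `W ↦ D𝐄(W)[Λ₋W − WΛ₊]` (`…B12Ward414.ward_second_order` with
the affine generator field `U ↦ L_Λ(1 + U)`: value `−∂Λ` at `U = 0`, derivative `L_Λ`, second derivative `0`).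
[cite: Balaban1987RG1, (4.7) p.282, (4.9)-(4.11) p.283] -/
theorem third_one_apply_grad_eq {ℰ : (Λ → T → 𝔄) → F} (e : Λ → T) (hℰ : ContDiffAt ℝ 3 ℰ 1) (Lam : T → 𝔄)
    (h47 : ∀ᶠ W in 𝓝 (1 : Λ → T → 𝔄), ∀ᶠ t in 𝓝 (0 : ℝ),
      ℰ (fun ν x => exp (t • Lam x) * W ν x * exp (-(t • Lam (x + e ν)))) = ℰ W) (U₁ U₂ : Λ → T → 𝔄) :
    fderiv ℝ (fderiv ℝ (fderiv ℝ ℰ)) 1 U₁ U₂ (fun ν y => Lam (y + e ν) - Lam y) =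
      fderiv ℝ (fderiv ℝ ℰ) 1 U₁ (fun ν x => Lam x * U₂ ν x - U₂ ν x * Lam (x + e ν)) +
        fderiv ℝ (fderiv ℝ ℰ) 1 U₂ (fun ν x => Lam x * U₁ ν x - U₁ ν x * Lam (x + e ν)) := by
  obtain ⟨L, hL⟩ := exists_generatorCLM e Lam
  set ℰ₁ : (Λ → T → 𝔄) → F := fun U => ℰ (1 + U) with hℰ₁
  have hD : ∀ U, fderiv ℝ ℰ₁ U = fderiv ℝ ℰ (1 + U) := fun U => fderiv_comp_add_left 1
  have hD' : fderiv ℝ ℰ₁ = fun U => fderiv ℝ ℰ (1 + U) := funext hD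
  have hDD' : fderiv ℝ (fderiv ℝ ℰ₁) = fun U => fderiv ℝ (fderiv ℝ ℰ) (1 + U) := by
    rw [hD']
    funext U
    exact fderiv_comp_add_left (𝕜 := ℝ) (f := fderiv ℝ ℰ) (x := U) (1 : Λ → T → 𝔄)
  have hDD : fderiv ℝ (fderiv ℝ ℰ₁) 0 = fderiv ℝ (fderiv ℝ ℰ) 1 := by
    rw [hDD']
    simp only [add_zero]
  have hDDD : fderiv ℝ (fderiv ℝ (fderiv ℝ ℰ₁)) 0 = fderiv ℝ (fderiv ℝ (fderiv ℝ ℰ)) 1 := by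
    rw [hDD']
    have h := fderiv_comp_add_left (𝕜 := ℝ) (f := fderiv ℝ (fderiv ℝ ℰ)) (x := (0 : Λ → T → 𝔄))
      (1 : Λ → T → 𝔄)
    rwa [add_zero] at h
  have h1C : ContDiffAt ℝ 3 ℰ₁ 0 := by
    have h : ContDiffAt ℝ 3 ℰ ((fun U : Λ → T → 𝔄 => 1 + U) 0) := by simpa using hℰ
    exact h.comp 0 (contDiffAt_const.add contDiffAt_id)
  have hdiff : ∀ᶠ W in 𝓝 (1 : Λ → T → 𝔄), DifferentiableAt ℝ ℰ W := by
    filter_upwards [hℰ.eventually (by simp)] with W hW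
    exact hW.differentiableAt (by simp)
  have hc : Tendsto (fun U : Λ → T → 𝔄 => 1 + U) (𝓝 0) (𝓝 1) := by
    have hcts : Continuous (fun U : Λ → T → 𝔄 => 1 + U) := by fun_prop
    simpa using hcts.tendsto 0
  have hX : ContDiffAt ℝ 2 (fun U : Λ → T → 𝔄 => L (1 + U)) 0 := by
    have h : ContDiffAt ℝ 2 (L : (Λ → T → 𝔄) → (Λ → T → 𝔄)) ((fun U : Λ → T → 𝔄 => 1 + U) 0) :=
      L.contDiff.contDiffAt
    exact h.comp 0 (contDiffAt_const.add contDiffAt_id)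
  have hXD' : fderiv ℝ (fun U : Λ → T → 𝔄 => L (1 + U)) = fun _ => L := by
    funext U
    rw [fderiv_comp_add_left, L.fderiv]
  have hXD : fderiv ℝ (fun U : Λ → T → 𝔄 => L (1 + U)) 0 = L := by
    rw [hXD']
  have hXDD : fderiv ℝ (fderiv ℝ (fun U : Λ → T → 𝔄 => L (1 + U))) 0 = 0 := by
    rw [hXD']
    simp
  have hL1 : L 1 = -(fun ν y => Lam (y + e ν) - Lam y) := by
    rw [hL]
    funext ν y
    simp
  have hinv : ∀ᶠ U in 𝓝 (0 : Λ → T → 𝔄), fderiv ℝ ℰ₁ U (L (1 + U)) = 0 := by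
    filter_upwards [hc.eventually (hdiff.and h47)] with U hU
    rw [hD, hL]
    exact fderiv_apply_gaugeGenerator_eq_zero e Lam hU.1 hU.2
  have h := ward_second_order (𝕜 := ℝ) h1C hX hinv U₁ U₂
  simp only [add_zero] at h
  rw [hXD, hXDD, _root_.zero_apply, _root_.zero_apply, map_zero, add_zero, hDDD, hDD,
    hL1, map_neg, add_assoc, neg_add_eq_zero] at h
  rw [h, hL, hL]

end WardSecondAmbient

/-! ## §5. (4.11) at `B = 0` IN THE CHART — `k₂ = 1/12` -/

section FourEleven

variable {𝔄 : Type*} [NormedRing 𝔄] [NormedAlgebra ℝ 𝔄] [CompleteSpace 𝔄] {Λ T : Type*} [Fintype Λ] [Fintype T]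
  [AddCommGroup T] {V : Type*} [NormedAddCommGroup V] [NormedSpace ℝ V] {F : Type*} [NormedAddCommGroup F]
  [NormedSpace ℝ F]

/-- Regrouping of nine terms (the shape of (4.11) at `B = 0` after the chain rules). [folklore] -/
private theorem comb_eq_of_sub_eq_zero {M : Type*} [AddCommGroup M] {a₁ a₂ b₁ b₂ g₁ g₂ g₃ g₄ r : M}
    (h : g₁ + g₂ - g₃ - g₄ - r = 0) :
    a₁ + a₂ + g₁ + b₁ + b₂ + g₂ - (a₁ + b₁ + g₃) - (a₂ + b₂ + g₄) = r := by
  rw [← sub_eq_zero, ← h]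
  abel

/-- **(4.11) AT `B = 0` IN THE CHART, for ONE `𝔤`-valued gauge function `λ`, WITHOUT (4.14)** (p. 283 (4.11) at
`B = 0`: «⟨(δ³/δB³)𝐄(exp iB), iad_{λ₋}B − g⁻¹(iad_B)∂λ, B₁, B₂⟩ + ⟨(δ²/δB²)𝐄(exp iB), iad_{λ₋}B₂ − ½iad_{B₂}∂λ −
k₂{iad_{B₂}, iad_B}∂λ − …, B₁⟩ + (B₁↔B₂) + ⟨(δ/δB)𝐄(exp iB), −k₂{iad_{B₁}, iad_{B₂}}∂λ − …⟩ = 0», with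
«g⁻¹(z) = … = 1 + ½z + k₂z² + …»): for `f(B) = 𝐄(exp ρB)` on `𝔤`-valued fields, `𝐄` `C³` at `1` and invariant under
the gauge flow (4.7) of `λ` near `1`, and ANY `𝔤`-valued fields `c_u`, `c_v` representing print's second variations
(`hcu`, `hcv`: `ρc_v = [ρλ₋, ρv] − ½[ρv, ρ∂λ]` bondwise):
`D³f(0)(u, v, ∂λ) − D²f(0)(u, c_v) − D²f(0)(v, c_u) = D𝐄(1)[(1/12)((U[P,V] − [P,V]U) + (V[P,U] − [P,U]V))]`,
`U = ρu`, `V = ρv`, `P = ρλ₊ − ρλ₋` — i.e. print's `⟨(δ/δB)𝐄(1), −k₂{iad_{B₁}, iad_{B₂}}∂λ⟩` with `k₂ = 1/12` COMPUTED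
(third-order chain rule + (4.11)|₀ ambient `third_one_apply_grad_eq` + (4.10)|₀ ambient
`…B12Semisimple414.hessian_one_apply_grad_eq` + the two pointwise identities of §3).
[cite: Balaban1987RG1, (4.7) p.282, (4.8)-(4.11) p.283] -/
theorem third_chart_apply_grad_eq {ℰ : (Λ → T → 𝔄) → F} (e : Λ → T) (ρ : V →L[ℝ] 𝔄) (hℰ : ContDiffAt ℝ 3 ℰ 1)
    (lam : T → V) (h47 : ∀ᶠ W in 𝓝 (1 : Λ → T → 𝔄), ∀ᶠ t in 𝓝 (0 : ℝ),
      ℰ (fun ν x => exp (t • ρ (lam x)) * W ν x * exp (-(t • ρ (lam (x + e ν))))) = ℰ W)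
    (u v cu cv : Λ → T → V)
    (hcu : ∀ ν x, ρ (cu ν x) = (ρ (lam x) * ρ (u ν x) - ρ (u ν x) * ρ (lam x)) -
      (2 : ℝ)⁻¹ • (ρ (u ν x) * (ρ (lam (x + e ν)) - ρ (lam x)) - (ρ (lam (x + e ν)) - ρ (lam x)) * ρ (u ν x)))
    (hcv : ∀ ν x, ρ (cv ν x) = (ρ (lam x) * ρ (v ν x) - ρ (v ν x) * ρ (lam x)) -
      (2 : ℝ)⁻¹ • (ρ (v ν x) * (ρ (lam (x + e ν)) - ρ (lam x)) - (ρ (lam (x + e ν)) - ρ (lam x)) * ρ (v ν x))) :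
    fderiv ℝ (fderiv ℝ (fderiv ℝ (fun B : Λ → T → V => ℰ (fun ν x => exp (ρ (B ν x)))))) 0 u v
        (fun ν y => lam (y + e ν) - lam y)
      - fderiv ℝ (fderiv ℝ (fun B : Λ → T → V => ℰ (fun ν x => exp (ρ (B ν x))))) 0 u cv
      - fderiv ℝ (fderiv ℝ (fun B : Λ → T → V => ℰ (fun ν x => exp (ρ (B ν x))))) 0 v cu =
      fderiv ℝ ℰ 1 (fun ν x => (12 : ℝ)⁻¹ •
        ((ρ (u ν x) * ((ρ (lam (x + e ν)) - ρ (lam x)) * ρ (v ν x) - ρ (v ν x) * (ρ (lam (x + e ν)) - ρ (lam x)))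
          - ((ρ (lam (x + e ν)) - ρ (lam x)) * ρ (v ν x) - ρ (v ν x) * (ρ (lam (x + e ν)) - ρ (lam x))) * ρ (u ν x))
        + (ρ (v ν x) * ((ρ (lam (x + e ν)) - ρ (lam x)) * ρ (u ν x) - ρ (u ν x) * (ρ (lam (x + e ν)) - ρ (lam x)))
          - ((ρ (lam (x + e ν)) - ρ (lam x)) * ρ (u ν x) - ρ (u ν x) * (ρ (lam (x + e ν)) - ρ (lam x))) *
            ρ (v ν x)))) := by
  have hℰ2 : ContDiffAt ℝ 2 ℰ 1 := hℰ.of_le (by norm_num)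
  rw [fderiv_fderiv_fderiv_comp_chart_zero_apply ρ hℰ, fderiv_fderiv_comp_chart_zero_apply ρ hℰ2,
    fderiv_fderiv_comp_chart_zero_apply ρ hℰ2]
  simp only [map_sub]
  rw [third_one_apply_grad_eq e hℰ (fun x => ρ (lam x)) h47,
    hessian_one_apply_grad_eq e hℰ2 (fun x => ρ (lam x)) h47]
  -- the two `D²𝐄(1)(ρu, ·)`, `D²𝐄(1)(ρv, ·)` slots: generator term + Jordan term = `ρ c`
  have hcv' : (fun ν x => ρ (cv ν x)) = (fun ν x => ρ (lam x) * ρ (v ν x) - ρ (v ν x) * ρ (lam (x + e ν))) +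
      fun ν x => (2 : ℝ)⁻¹ • (ρ (v ν x) * (ρ (lam (x + e ν)) - ρ (lam x)) +
        (ρ (lam (x + e ν)) - ρ (lam x)) * ρ (v ν x)) := by
    funext ν x
    simp only [Pi.add_apply]
    rw [hcv ν x]
    exact (gen_add_jordan_eq_commutator_sub _ _ _).symm
  have hcu' : (fun ν x => ρ (cu ν x)) = (fun ν x => ρ (lam x) * ρ (u ν x) - ρ (u ν x) * ρ (lam (x + e ν))) +
      fun ν x => (2 : ℝ)⁻¹ • (ρ (u ν x) * (ρ (lam (x + e ν)) - ρ (lam x)) +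
        (ρ (lam (x + e ν)) - ρ (lam x)) * ρ (u ν x)) := by
    funext ν x
    simp only [Pi.add_apply]
    rw [hcu ν x]
    exact (gen_add_jordan_eq_commutator_sub _ _ _).symm
  rw [hcv', hcu', map_add, map_add]
  simp only [hcu, hcv]
  apply comb_eq_of_sub_eq_zero
  rw [← map_add, ← map_sub, ← map_sub, ← map_sub]
  refine (congrArg (fderiv ℝ ℰ 1) ?_).trans (map_zero _)
  funext ν x
  simp only [Pi.add_apply, Pi.sub_apply, Pi.zero_apply]
  rw [sub_eq_zero]
  exact residual_eq_twelfth_double_commutators _ _ _ _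

end FourEleven

/-! ## §6. (4.7) + «G is semisimple» ⇒ (4.15)₂ at `B = 0` in the chart; p. 289: infinitesimal (4.32) -/

section FourFifteenTwo

variable {𝔄 : Type*} [NormedRing 𝔄] [NormedAlgebra ℝ 𝔄] [CompleteSpace 𝔄] {Λ T : Type*} [Fintype Λ] [Fintype T]
  [AddCommGroup T] {V : Type*} [NormedAddCommGroup V] [NormedSpace ℝ V] {F : Type*} [NormedAddCommGroup F]
  [NormedSpace ℝ F]

/-- **(4.7) + closure + perfectness ⇒ (4.15)₂ AT `B = 0` IN THE CHART `V = exp iB` OF `𝔤`-VALUED FIELDS** (p. 284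
«We obtain the following set of Ward-Takahashi identities …, ⟨(δ³/δB³)𝐄(1), B₁, B₂, ∂λ⟩ − ⟨(δ²/δB²)𝐄(1), B₁, i[λ₋, B₂]
− ½i[B₂, ∂λ]⟩ − (B₁↔B₂) = 0, … for an arbitrary gauge function λ, and arbitrary gauge fields B₁, B₂, B₃.»): for `𝐄`
`C³` at `V = 1` and invariant near `1` under the gauge flows (4.7) of every `𝔤`-valued gauge function for small `t`,
with `𝔤` (read through `ρ`) CLOSED under commutators (`hcl`) and SPANNED by them (`hspan`) — both automatic for `G`
semisimple, `…_of_isSemisimple` below —, and ANY `𝔤`-valued representatives `c_{B₁}`, `c_{B₂}` of print's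
`i[λ₋, B₁] − ½i[B₁, ∂λ]`, `i[λ₋, B₂] − ½i[B₂, ∂λ]` (`hcu`, `hcv`):
`D³f(0)(B₁, B₂, ∂λ) − D²f(0)(B₁, c_{B₂}) − D²f(0)(B₂, c_{B₁}) = 0`, `f(B) = 𝐄(exp ρB)`.  Proof = print's: by (4.11) at
`B = 0` (`third_chart_apply_grad_eq`) the left side is `D𝐄(1)` of the `𝔤`-valued field `(1/12)([B₁,[∂λ,B₂]] +
[B₂,[∂λ,B₁]])` (closure twice), which (4.14) (`…B12Semisimple414.fderiv_one_apply_rho_eq_zero`) kills.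
[cite: Balaban1987RG1, (4.7) p.282, (4.11) p.283, (4.14)-(4.15) p.284] -/
theorem third_chart_apply_grad_eq_zero {ℰ : (Λ → T → 𝔄) → F} (e : Λ → T) (ρ : V →L[ℝ] 𝔄)
    (hℰ : ContDiffAt ℝ 3 ℰ 1)
    (h47 : ∀ lam : T → V, ∀ᶠ W in 𝓝 (1 : Λ → T → 𝔄), ∀ᶠ t in 𝓝 (0 : ℝ),
      ℰ (fun ν x => exp (t • ρ (lam x)) * W ν x * exp (-(t • ρ (lam (x + e ν))))) = ℰ W)
    (hcl : ∀ a b : V, ∃ c : V, ρ c = ρ a * ρ b - ρ b * ρ a)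
    (hspan : Submodule.span ℝ {c : V | ∃ l v : V, ρ c = ρ l * ρ v - ρ v * ρ l} = ⊤)
    (u v cu cv : Λ → T → V) (lam : T → V)
    (hcu : ∀ ν x, ρ (cu ν x) = (ρ (lam x) * ρ (u ν x) - ρ (u ν x) * ρ (lam x)) -
      (2 : ℝ)⁻¹ • (ρ (u ν x) * (ρ (lam (x + e ν)) - ρ (lam x)) - (ρ (lam (x + e ν)) - ρ (lam x)) * ρ (u ν x)))
    (hcv : ∀ ν x, ρ (cv ν x) = (ρ (lam x) * ρ (v ν x) - ρ (v ν x) * ρ (lam x)) -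
      (2 : ℝ)⁻¹ • (ρ (v ν x) * (ρ (lam (x + e ν)) - ρ (lam x)) - (ρ (lam (x + e ν)) - ρ (lam x)) * ρ (v ν x))) :
    fderiv ℝ (fderiv ℝ (fderiv ℝ (fun B : Λ → T → V => ℰ (fun ν x => exp (ρ (B ν x)))))) 0 u v
        (fun ν y => lam (y + e ν) - lam y)
      - fderiv ℝ (fderiv ℝ (fun B : Λ → T → V => ℰ (fun ν x => exp (ρ (B ν x))))) 0 u cv
      - fderiv ℝ (fderiv ℝ (fun B : Λ → T → V => ℰ (fun ν x => exp (ρ (B ν x))))) 0 v cu = 0 := by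
  choose κ hκ using hcl
  rw [third_chart_apply_grad_eq e ρ hℰ lam (h47 lam) u v cu cv hcu hcv]
  have h414 := fderiv_one_apply_rho_eq_zero e ρ (hℰ.of_le (by norm_num)) (fun l => h47 (fun _ => l)) hspan
    (fun ν x => (12 : ℝ)⁻¹ • (κ (u ν x) (κ (lam (x + e ν) - lam x) (v ν x)) +
      κ (v ν x) (κ (lam (x + e ν) - lam x) (u ν x))))
  simpa only [map_smul, map_add, map_sub, hκ] using h414

/-- **(4.15)₂ at `B = 0` in the chart, the second variations built from a bracket**: as
`third_chart_apply_grad_eq_zero`, with `c_{B₂} = br(λ₋, B₂) − ½ br(B₂, ∂λ)` for any `br : 𝔤 × 𝔤 → 𝔤` represented by the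
commutator (`hbr : ρ(br a b) = ρa·ρb − ρb·ρa` — print's `i[·, ·]`; closure is then automatic).
[cite: Balaban1987RG1, (4.7) p.282, (4.14)-(4.15) p.284] -/
theorem third_chart_apply_grad_eq_zero_of_bracket {ℰ : (Λ → T → 𝔄) → F} (e : Λ → T) (ρ : V →L[ℝ] 𝔄)
    (hℰ : ContDiffAt ℝ 3 ℰ 1)
    (h47 : ∀ lam : T → V, ∀ᶠ W in 𝓝 (1 : Λ → T → 𝔄), ∀ᶠ t in 𝓝 (0 : ℝ),
      ℰ (fun ν x => exp (t • ρ (lam x)) * W ν x * exp (-(t • ρ (lam (x + e ν))))) = ℰ W)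
    (br : V → V → V) (hbr : ∀ a b : V, ρ (br a b) = ρ a * ρ b - ρ b * ρ a)
    (hspan : Submodule.span ℝ {c : V | ∃ l v : V, ρ c = ρ l * ρ v - ρ v * ρ l} = ⊤)
    (u v : Λ → T → V) (lam : T → V) :
    fderiv ℝ (fderiv ℝ (fderiv ℝ (fun B : Λ → T → V => ℰ (fun ν x => exp (ρ (B ν x)))))) 0 u v
        (fun ν y => lam (y + e ν) - lam y)
      - fderiv ℝ (fderiv ℝ (fun B : Λ → T → V => ℰ (fun ν x => exp (ρ (B ν x))))) 0 u
          (fun ν x => br (lam x) (v ν x) - (2 : ℝ)⁻¹ • br (v ν x) (lam (x + e ν) - lam x))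
      - fderiv ℝ (fderiv ℝ (fun B : Λ → T → V => ℰ (fun ν x => exp (ρ (B ν x))))) 0 v
          (fun ν x => br (lam x) (u ν x) - (2 : ℝ)⁻¹ • br (u ν x) (lam (x + e ν) - lam x)) = 0 :=
  third_chart_apply_grad_eq_zero e ρ hℰ h47 (fun a b => ⟨br a b, hbr a b⟩) hspan u v _ _ lam
    (fun ν x => by simp only [map_sub, map_smul, hbr]) (fun ν x => by simp only [map_sub, map_smul, hbr])

/-- **(4.7) + «The group G is semisimple» ⇒ (4.15)₂ at `B = 0` in the chart**:
`third_chart_apply_grad_eq_zero_of_bracket` for the charge space `V` a finite-dimensional SEMISIMPLE real Lie algebra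
`𝔤` (any linear identification `eV`) represented in `𝔄` by `ρ` (`hρ`: `ρ` intertwines the bracket with the
commutator — print's `𝔤^c ⊂ M_N(ℂ)`), the second variations being `[λ₋, B₂] − ½[B₂, ∂λ]` computed in `𝔤`; closure
is automatic and perfectness comes by name from the parent (`span_commutatorSet_eq_top_of_isSemisimple`, Cartan's
criterion in Mathlib).
[cite: Balaban1987RG1, (4.7) p.282, (4.14)-(4.15) p.284] -/
theorem third_chart_apply_grad_eq_zero_of_isSemisimple {𝔤 : Type*} [LieRing 𝔤] [LieAlgebra ℝ 𝔤]
    [FiniteDimensional ℝ 𝔤] [LieAlgebra.IsSemisimple ℝ 𝔤] (eV : V ≃ₗ[ℝ] 𝔤) {ℰ : (Λ → T → 𝔄) → F} (e : Λ → T)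
    (ρ : V →L[ℝ] 𝔄) (hρ : ∀ a b : V, ρ (eV.symm ⁅eV a, eV b⁆) = ρ a * ρ b - ρ b * ρ a)
    (hℰ : ContDiffAt ℝ 3 ℰ 1)
    (h47 : ∀ lam : T → V, ∀ᶠ W in 𝓝 (1 : Λ → T → 𝔄), ∀ᶠ t in 𝓝 (0 : ℝ),
      ℰ (fun ν x => exp (t • ρ (lam x)) * W ν x * exp (-(t • ρ (lam (x + e ν))))) = ℰ W)
    (u v : Λ → T → V) (lam : T → V) :
    fderiv ℝ (fderiv ℝ (fderiv ℝ (fun B : Λ → T → V => ℰ (fun ν x => exp (ρ (B ν x)))))) 0 u v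
        (fun ν y => lam (y + e ν) - lam y)
      - fderiv ℝ (fderiv ℝ (fun B : Λ → T → V => ℰ (fun ν x => exp (ρ (B ν x))))) 0 u
          (fun ν x => eV.symm ⁅eV (lam x), eV (v ν x)⁆ -
            (2 : ℝ)⁻¹ • eV.symm ⁅eV (v ν x), eV (lam (x + e ν) - lam x)⁆)
      - fderiv ℝ (fderiv ℝ (fun B : Λ → T → V => ℰ (fun ν x => exp (ρ (B ν x))))) 0 v
          (fun ν x => eV.symm ⁅eV (lam x), eV (u ν x)⁆ -
            (2 : ℝ)⁻¹ • eV.symm ⁅eV (u ν x), eV (lam (x + e ν) - lam x)⁆) = 0 :=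
  third_chart_apply_grad_eq_zero_of_bracket e ρ hℰ h47 (fun a b => eV.symm ⁅eV a, eV b⁆) hρ
    (span_commutatorSet_eq_top_of_isSemisimple eV ρ hρ) u v lam

/-- **p. 289, after (4.32) «⟨𝐄^{(2)}, R(v)B, R(v)B⟩ = ⟨𝐄^{(2)}, B, B⟩, v ∈ G» and (4.33): «The infinitesimal form of
this identity is a consequence of (4.11), or the second identity in (4.15).»** — here: (4.15)₂ at `B = 0` for a CONSTANT
gauge function `λ = l ∈ 𝔤` (`∂λ = 0`) gives `D²f(0)(B₁, c_{B₂}) + D²f(0)(B₂, c_{B₁}) = 0` for any representatives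
`ρc_{B₂} = [ρl, ρB₂]`, `ρc_{B₁} = [ρl, ρB₁]` (`f(B) = 𝐄(exp ρB)`), i.e. the quadratic form `D²f(0)` on `𝔤`-valued
fields is infinitesimally `Ad`-invariant (print's `𝐄^{(2)}` and `R(v)` themselves are not modelled here).
[cite: Balaban1987RG1, (4.15) p.284, (4.32)-(4.33) p.289] -/
theorem hessian_chart_ad_invariant {ℰ : (Λ → T → 𝔄) → F} (e : Λ → T) (ρ : V →L[ℝ] 𝔄) (hℰ : ContDiffAt ℝ 3 ℰ 1)
    (h47 : ∀ lam : T → V, ∀ᶠ W in 𝓝 (1 : Λ → T → 𝔄), ∀ᶠ t in 𝓝 (0 : ℝ),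
      ℰ (fun ν x => exp (t • ρ (lam x)) * W ν x * exp (-(t • ρ (lam (x + e ν))))) = ℰ W)
    (hcl : ∀ a b : V, ∃ c : V, ρ c = ρ a * ρ b - ρ b * ρ a)
    (hspan : Submodule.span ℝ {c : V | ∃ l v : V, ρ c = ρ l * ρ v - ρ v * ρ l} = ⊤)
    (l : V) (u v cu cv : Λ → T → V) (hcu : ∀ ν x, ρ (cu ν x) = ρ l * ρ (u ν x) - ρ (u ν x) * ρ l)
    (hcv : ∀ ν x, ρ (cv ν x) = ρ l * ρ (v ν x) - ρ (v ν x) * ρ l) :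
    fderiv ℝ (fderiv ℝ (fun B : Λ → T → V => ℰ (fun ν x => exp (ρ (B ν x))))) 0 u cv +
      fderiv ℝ (fderiv ℝ (fun B : Λ → T → V => ℰ (fun ν x => exp (ρ (B ν x))))) 0 v cu = 0 := by
  have h := third_chart_apply_grad_eq_zero e ρ hℰ h47 hcl hspan u v cu cv (fun _ => l)
    (fun ν x => by rw [hcu]; simp) (fun ν x => by rw [hcv]; simp)
  have h0 : (fun (ν : Λ) (y : T) => l - l) = (0 : Λ → T → V) := by
    funext ν y
    simp
  simp only [h0, map_zero, zero_sub] at h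
  rw [← neg_eq_zero, ← h]
  abel

/-- p. 289, infinitesimal `Ad`-invariance of `D²f(0)` for `G` semisimple: `D²f(0)(B₁, [l, B₂]) + D²f(0)(B₂, [l, B₁]) =
0`, brackets computed in `𝔤` (`hessian_chart_ad_invariant` with closure and perfectness from
`LieAlgebra.IsSemisimple ℝ 𝔤`). [cite: Balaban1987RG1, (4.15) p.284, (4.32)-(4.33) p.289] -/
theorem hessian_chart_ad_invariant_of_isSemisimple {𝔤 : Type*} [LieRing 𝔤] [LieAlgebra ℝ 𝔤]
    [FiniteDimensional ℝ 𝔤] [LieAlgebra.IsSemisimple ℝ 𝔤] (eV : V ≃ₗ[ℝ] 𝔤) {ℰ : (Λ → T → 𝔄) → F} (e : Λ → T)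
    (ρ : V →L[ℝ] 𝔄) (hρ : ∀ a b : V, ρ (eV.symm ⁅eV a, eV b⁆) = ρ a * ρ b - ρ b * ρ a)
    (hℰ : ContDiffAt ℝ 3 ℰ 1)
    (h47 : ∀ lam : T → V, ∀ᶠ W in 𝓝 (1 : Λ → T → 𝔄), ∀ᶠ t in 𝓝 (0 : ℝ),
      ℰ (fun ν x => exp (t • ρ (lam x)) * W ν x * exp (-(t • ρ (lam (x + e ν))))) = ℰ W)
    (l : V) (u v : Λ → T → V) :
    fderiv ℝ (fderiv ℝ (fun B : Λ → T → V => ℰ (fun ν x => exp (ρ (B ν x))))) 0 u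
        (fun ν x => eV.symm ⁅eV l, eV (v ν x)⁆) +
      fderiv ℝ (fderiv ℝ (fun B : Λ → T → V => ℰ (fun ν x => exp (ρ (B ν x))))) 0 v
        (fun ν x => eV.symm ⁅eV l, eV (u ν x)⁆) = 0 :=
  hessian_chart_ad_invariant e ρ hℰ h47 (exists_rho_eq_commutator eV ρ hρ)
    (span_commutatorSet_eq_top_of_isSemisimple eV ρ hρ) l u v _ _ (fun _ _ => hρ _ _) (fun _ _ => hρ _ _)

end FourFifteenTwo

end Literature.MathematicalPhysics.QuantumFieldTheory.Balaban1983to89.B12WardSecond415
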